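import Mathlib
import Summits.Ventures.HodgeRepro2.T5AdicCompletionConjugation
import Summits.Ventures.HodgeRepro2.T5ExistsCharacter
import Summits.Ventures.HodgeRepro2.T5BallAnnihilator
import Summits.Ventures.HodgeRepro2.T5CharactersTrivialOnBase
import Summits.Ventures.HodgeRepro2.T5QuadraticGalois

/-!
# The normalised character `ψ₀` of Lemma N5.L5 exists at an inert place: trivial on `Kv` and on
  `P_E`, non-trivial on `O_E` (`n(ψ₀) = −1`)

Lemma N5.L5 uses «`ψ₀` trivial on `F_v` and on `P_E` and non-trivial on `O_E`, i.e. `n(ψ₀) = −1`»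
([GGP-ex-Prop-4]'s normalisation).  On Mathlib's completions `Kv ⊆ Lw` at an INERT place with a
non-trivial automorphism `σ`:

* `exists_char_conductor_neg_one`: `Kv` has a continuous character of exact conductor `−1`
  (`T5ExistsCharacter` + a shift, `T5BallCharacters`);
* `exists_pow_mul_mem`, `exists_eq_algebraMap_add_mul`, `eq_zero_of_add_mul_eq_zero`: the unramified
  integral basis element `θ` of `T5AdicCompletionConjugation` gives a `Kv`-basis `(1, θ)` of `Lw`
  (`basisOfSpanUniq`) whose coordinates of integral elements are integral (`coordHom_integral`);
* `exists_char_trivial_on_base_conductor_neg_one`: for `ψ_F` of exact conductor `−1`,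
  `ψ₀ := ofBase (1, θ) ψ_F` is a CONTINUOUS character of `Lw`, trivial on `Kv`, trivial on
  `B (−1) = P_E` and non-trivial on `B 0 = O_E`.

Declaration per README §8(d): «uses an L-value-free non-vanishing device: NO».
-/

namespace Summit.Ventures.HodgeRepro2.T5InertNormalizedCharacter

open IsDedekindDomain HeightOneSpectrum WithZero T5CharactersTrivialOnBase T5BallCharacters

section Base

variable {K : Type*} [Field K] [NumberField K] (v : HeightOneSpectrum (NumberField.RingOfIntegers K))

/-- `Kv` has a continuous character of EXACT conductor `−1` (trivial on `B (−1)`, non-trivial on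
`B 0`). -/
theorem exists_char_conductor_neg_one :
    ∃ ψ : AddChar (adicCompletion K v) Circle, Continuous ψ ∧
      (∀ x : adicCompletion K v, Valued.v x ≤ exp (-1) → ψ x = 1) ∧
      ∃ y : adicCompletion K v, Valued.v y ≤ exp 0 ∧ ψ y ≠ 1 := by
  obtain ⟨ψ, hψc, hψ⟩ := T5ExistsCharacter.exists_continuous_ne_one_adicCompletion (K := K) v
  obtain ⟨c, hc1, hc2⟩ := T5LocalSelfDuality.exists_conductor ψ hψc hψ
  obtain ⟨u, hu⟩ := T5AdicCompletionSelfDuality.exists_val_eq_exp (K := K) v (c + 1)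
  refine ⟨ψ.mulShift u, T5BallAnnihilator.continuous_mulShift ψ hψc u, ?_, ?_⟩
  · intro x hx
    rw [AddChar.mulShift_apply]
    exact forall_mulShift_eq_one_of_val_le ψ hc1 (by rw [hu]; exact exp_le_exp.2 (by omega)) x hx
  · by_contra h
    have h' : ∀ x : adicCompletion K v, Valued.v x ≤ exp 0 → ψ (u * x) = 1 := fun x hx =>
      by_contra fun hne => h ⟨x, hx, by rw [AddChar.mulShift_apply]; exact hne⟩
    have := val_le_of_forall_mulShift_eq_one ψ hc2 h'
    rw [hu, exp_le_exp] at this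
    omega

end Base

section Extension

variable {K : Type*} [Field K] [NumberField K] (v : HeightOneSpectrum (NumberField.RingOfIntegers K))
  {L : Type*} [Field L] [NumberField L] [Algebra K L]
  (w : HeightOneSpectrum (NumberField.RingOfIntegers L)) [w.asIdeal.LiesOver v.asIdeal]

/-- The coordinate of `a • b 0 + c • b 1` is `c` (for `b 0 = 1`). -/
theorem coordHom_add_smul (b : Module.Basis (Fin 2) (adicCompletion K v) (adicCompletion L w))
    (hb0 : b 0 = 1) (a c : adicCompletion K v) : coordHom b (a • b 0 + c • b 1) = c := by
  rw [map_add, coordHom_smul, hb0, ← Algebra.algebraMap_eq_smul_one, coordHom_algebraMap b hb0,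
    zero_add]

/-- `w (alg ϖ) = exp (−1)` at an inert place, as a valuation of `Lw`. -/
theorem val_algebraMap_irreducible {ϖ : adicCompletionIntegers K v}
    (hϖS : Irreducible (algebraMap (adicCompletionIntegers K v) (adicCompletionIntegers L w) ϖ)) :
    Valued.v (algebraMap (adicCompletion K v) (adicCompletion L w) (ϖ : adicCompletion K v)) =
      exp (-1) :=
  T5UnramifiedCharacter.val_algebraMap_eq_exp_neg_one v w hϖS

/-- Every `y ∈ Lw` is moved into `O_Lw` by a power of the uniformiser `ϖ` of `Kv`. -/
theorem exists_pow_mul_mem {ϖ : adicCompletionIntegers K v}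
    (hϖS : Irreducible (algebraMap (adicCompletionIntegers K v) (adicCompletionIntegers L w) ϖ))
    (y : adicCompletion L w) :
    ∃ n : ℕ, algebraMap (adicCompletion K v) (adicCompletion L w) ((ϖ : adicCompletion K v) ^ n) * y ∈
      adicCompletionIntegers L w := by
  by_cases hy : y = 0
  · exact ⟨0, by simp [hy]⟩
  have hvy : Valued.v y ≠ 0 := by simpa using hy
  obtain ⟨j, hj⟩ : ∃ j : ℤ, Valued.v y = exp j := ⟨_, (exp_log hvy).symm⟩
  refine ⟨j.toNat, ?_⟩
  rw [mem_adicCompletionIntegers, map_mul, map_pow, map_pow, val_algebraMap_irreducible v w hϖS, hj,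
    ← exp_nsmul, ← exp_add]
  show exp _ ≤ exp 0
  rw [exp_le_exp]
  have := Int.self_le_toNat j
  simp only [smul_neg, nsmul_eq_mul, mul_one]
  omega

/-- `Lw = Kv + Kv θ` for the integral basis element `θ` (`O_Lw = O_Kv + O_Kv θ`). -/
theorem exists_eq_algebraMap_add_mul {ϖ : adicCompletionIntegers K v}
    (hϖS : Irreducible (algebraMap (adicCompletionIntegers K v) (adicCompletionIntegers L w) ϖ))
    {θ : adicCompletionIntegers L w}
    (hθ : ∀ s : adicCompletionIntegers L w, ∃ a b : adicCompletionIntegers K v,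
      s = algebraMap _ _ a + algebraMap _ _ b * θ) (y : adicCompletion L w) :
    ∃ a c : adicCompletion K v, y = algebraMap (adicCompletion K v) (adicCompletion L w) a +
      algebraMap (adicCompletion K v) (adicCompletion L w) c * (θ : adicCompletion L w) := by
  obtain ⟨n, hn⟩ := exists_pow_mul_mem v w hϖS y
  obtain ⟨a, b, hab⟩ := hθ ⟨_, hn⟩
  have hab' : algebraMap (adicCompletion K v) (adicCompletion L w) ((ϖ : adicCompletion K v) ^ n) * y =
      algebraMap (adicCompletion K v) (adicCompletion L w) (a : adicCompletion K v) +
        algebraMap (adicCompletion K v) (adicCompletion L w) (b : adicCompletion K v) *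
          (θ : adicCompletion L w) := by
    have := congrArg (fun z : adicCompletionIntegers L w => (z : adicCompletion L w)) hab
    simpa using this
  have hϖ0 : (ϖ : adicCompletion K v) ≠ 0 := by
    intro h
    have := hϖS.ne_zero
    apply this
    apply Subtype.ext
    show ((algebraMap (adicCompletionIntegers K v) (adicCompletionIntegers L w) ϖ :
      adicCompletionIntegers L w) : adicCompletion L w) = 0
    change algebraMap (adicCompletion K v) (adicCompletion L w) (ϖ : adicCompletion K v) = 0
    rw [h, map_zero]
  refine ⟨((ϖ : adicCompletion K v) ^ n)⁻¹ * a, ((ϖ : adicCompletion K v) ^ n)⁻¹ * b, ?_⟩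
  have hpow : (ϖ : adicCompletion K v) ^ n ≠ 0 := pow_ne_zero n hϖ0
  rw [map_mul, map_mul, mul_assoc, ← mul_add, ← hab', ← mul_assoc, map_inv₀,
    inv_mul_cancel₀ ((map_ne_zero _).2 hpow), one_mul]

/-- `θ ∉ Kv` when `θ − σ θ` is a unit. -/
theorem notMem_range_of_isUnit_sub
    (σ : adicCompletion L w ≃ₐ[adicCompletion K v] adicCompletion L w)
    {θ : adicCompletionIntegers L w}
    (hθu : IsUnit (θ - T5AdicCompletionConjugation.restrictIntegers v w σ θ)) :
    (θ : adicCompletion L w) ∉ Set.range (algebraMap (adicCompletion K v) (adicCompletion L w)) := by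
  rintro ⟨x, hx⟩
  have hfix : T5AdicCompletionConjugation.restrictIntegers v w σ θ = θ := by
    apply Subtype.ext
    rw [T5AdicCompletionConjugation.coe_restrictIntegers, ← hx, σ.commutes]
  rw [hfix, sub_self] at hθu
  exact not_isUnit_zero hθu

/-- Uniqueness of the coordinates in `Kv + Kv θ`. -/
theorem eq_zero_of_add_mul_eq_zero {θ : adicCompletion L w}
    (hθ : θ ∉ Set.range (algebraMap (adicCompletion K v) (adicCompletion L w)))
    (a c : adicCompletion K v)
    (h : algebraMap (adicCompletion K v) (adicCompletion L w) a +
      algebraMap (adicCompletion K v) (adicCompletion L w) c * θ = 0) : a = 0 ∧ c = 0 := by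
  by_cases hc : c = 0
  · subst hc
    rw [map_zero, zero_mul, add_zero] at h
    exact ⟨(map_eq_zero _).1 h, rfl⟩
  · exfalso
    apply hθ
    refine ⟨-a / c, ?_⟩
    rw [map_div₀, map_neg, div_eq_iff ((map_ne_zero _).2 hc)]
    linear_combination -h

end Extension

section Normalised

variable {K : Type*} [Field K] [NumberField K] (v : HeightOneSpectrum (NumberField.RingOfIntegers K))
  {L : Type*} [Field L] [NumberField L] [Algebra K L]
  (w : HeightOneSpectrum (NumberField.RingOfIntegers L)) [w.asIdeal.LiesOver v.asIdeal]
  (h2 : Module.finrank (adicCompletion K v) (adicCompletion L w) = 2)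
  (σ : adicCompletion L w ≃ₐ[adicCompletion K v] adicCompletion L w) (hσ : σ ≠ 1)
  {ϖ : adicCompletionIntegers K v} (hϖ : Irreducible ϖ)
  (hϖS : Irreducible (algebraMap (adicCompletionIntegers K v) (adicCompletionIntegers L w) ϖ))

include h2 hσ hϖ hϖS

/-- THE NORMALISED `ψ₀` OF LEMMA N5.L5 EXISTS: a continuous character of `Lw`, trivial on `Kv`, trivial
on `B (−1) = P_E`, non-trivial on `B 0 = O_E`; it is `ofBase (1, θ) ψ_F` for the unramified integral
basis element `θ` and a `ψ_F` of exact conductor `−1`. -/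
theorem exists_char_trivial_on_base_conductor_neg_one :
    ∃ ψ₀ : AddChar (adicCompletion L w) Circle, Continuous ψ₀ ∧
      (∀ a : adicCompletion K v, ψ₀ (algebraMap _ _ a) = 1) ∧
      (∀ y : adicCompletion L w, Valued.v y ≤ exp (-1) → ψ₀ y = 1) ∧
      ∃ y : adicCompletion L w, Valued.v y ≤ exp 0 ∧ ψ₀ y ≠ 1 := by
  obtain ⟨ψF, hψc, hψ1, c, hc, hψc1⟩ := exists_char_conductor_neg_one (K := K) v
  obtain ⟨θ, hθu, hθ⟩ := T5AdicCompletionConjugation.exists_integralBasis v w h2 σ hσ hϖ hϖS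
  have hnot := notMem_range_of_isUnit_sub v w σ hθu
  have hspan := exists_eq_algebraMap_add_mul v w hϖS hθ
  have huniq : ∀ a c : adicCompletion K v, algebraMap (adicCompletion K v) (adicCompletion L w) a +
      algebraMap (adicCompletion K v) (adicCompletion L w) c * (θ : adicCompletion L w) = 0 →
      a = 0 ∧ c = 0 := fun a c h => eq_zero_of_add_mul_eq_zero v w hnot a c h
  set b := basisOfSpanUniq (θ : adicCompletion L w) hspan huniq with hb
  have hb0 : b 0 = 1 := basisOfSpanUniq_zero _ hspan huniq
  have hb1 : b 1 = θ := basisOfSpanUniq_one _ hspan huniq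
  -- coordinates of integral elements
  have hcoord : ∀ s : adicCompletionIntegers L w, ∃ b' : adicCompletionIntegers K v,
      coordHom b (s : adicCompletion L w) = b' := by
    intro s
    obtain ⟨a, b', hab⟩ := hθ s
    refine ⟨b', ?_⟩
    have : (s : adicCompletion L w) = (a : adicCompletion K v) • b 0 + (b' : adicCompletion K v) • b 1 := by
      rw [hb0, hb1, Algebra.smul_def, Algebra.smul_def, mul_one]
      exact congrArg (fun z : adicCompletionIntegers L w => (z : adicCompletion L w)) hab
    rw [this, coordHom_add_smul v w b hb0]
  refine ⟨ofBase b ψF, ?_, ofBase_algebraMap b hb0 ψF, ?_, ?_⟩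
  · -- continuity: `ofBase b ψF = ψF ∘ (b.coord 1)`
    have : ((ofBase b ψF : AddChar (adicCompletion L w) Circle) : adicCompletion L w → Circle) =
        fun y => ψF ((b.coord 1) y) := by
      funext y
      rw [ofBase_apply, coordHom_apply, Module.Basis.coord_apply]
    rw [this]
    exact hψc.comp (b.coord 1).continuous_of_finiteDimensional
  · -- trivial on `B (−1)`: `y = ϖ z` with `z` integral
    intro y hy
    have hz : y / algebraMap (adicCompletion K v) (adicCompletion L w) (ϖ : adicCompletion K v) ∈
        adicCompletionIntegers L w := by
      rw [mem_adicCompletionIntegers, map_div₀, val_algebraMap_irreducible v w hϖS,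
        div_le_iff₀ (by simp)]
      rw [one_mul]
      exact hy
    obtain ⟨b', hb'⟩ := hcoord ⟨_, hz⟩
    have hϖ0 : algebraMap (adicCompletion K v) (adicCompletion L w) (ϖ : adicCompletion K v) ≠ 0 := by
      intro h
      have := val_algebraMap_irreducible v w hϖS
      rw [h, map_zero] at this
      exact WithZero.exp_ne_zero this.symm
    have hy' : y = (ϖ : adicCompletion K v) • (y / algebraMap (adicCompletion K v)
        (adicCompletion L w) (ϖ : adicCompletion K v)) := by
      rw [Algebra.smul_def, mul_div_cancel₀ _ hϖ0]
    rw [ofBase_apply, hy', coordHom_apply, map_smul, Finsupp.smul_apply, smul_eq_mul,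
      ← coordHom_apply, hb']
    apply hψ1
    rw [map_mul, (T5AdicCompletionConductor.irreducible_iff_val_eq_exp_neg_one v ϖ).1 hϖ]
    have hb'1 : Valued.v (b' : adicCompletion K v) ≤ 1 := (mem_adicCompletionIntegers _ _ _).1 b'.2
    calc exp (-1) * Valued.v (b' : adicCompletion K v) ≤ exp (-1) * 1 := by gcongr
      _ = exp (-1) := mul_one _
  · -- non-trivial on `B 0`: `y = c • θ` with `ψ_F c ≠ 1`
    refine ⟨c • (θ : adicCompletion L w), ?_, ?_⟩
    · rw [Algebra.smul_def, map_mul]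
      have h1 : Valued.v (algebraMap (adicCompletion K v) (adicCompletion L w) c) ≤ 1 :=
        (T5ContinuousValuationExtension.val_algebraMap_le_one_iff (K := K) (L := L) (v := v)
          (w := w) c).2 (by simpa using hc)
      have h2' : Valued.v (θ : adicCompletion L w) ≤ 1 := (mem_adicCompletionIntegers _ _ _).1 θ.2
      rw [exp_zero]
      calc Valued.v (algebraMap (adicCompletion K v) (adicCompletion L w) c) *
            Valued.v (θ : adicCompletion L w) ≤ 1 * 1 := by gcongr
        _ = 1 := mul_one _
    · rw [ofBase_apply, ← hb1, coordHom_smul]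
      exact hψc1

end Normalised

section SigmaFree

variable {K : Type*} [Field K] [NumberField K] (v : HeightOneSpectrum (NumberField.RingOfIntegers K))
  {L : Type*} [Field L] [NumberField L] [Algebra K L]
  (w : HeightOneSpectrum (NumberField.RingOfIntegers L)) [w.asIdeal.LiesOver v.asIdeal]

/-- The normalised `ψ₀` of Lemma N5.L5 exists at every inert quadratic place — no automorphism in
the hypotheses (`T5QuadraticGalois` supplies one). -/
theorem exists_char_trivial_on_base_conductor_neg_one'
    (h2 : Module.finrank (adicCompletion K v) (adicCompletion L w) = 2)
    {ϖ : adicCompletionIntegers K v} (hϖ : Irreducible ϖ)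
    (hϖS : Irreducible (algebraMap (adicCompletionIntegers K v) (adicCompletionIntegers L w) ϖ)) :
    ∃ ψ₀ : AddChar (adicCompletion L w) Circle, Continuous ψ₀ ∧
      (∀ a : adicCompletion K v, ψ₀ (algebraMap _ _ a) = 1) ∧
      (∀ y : adicCompletion L w, Valued.v y ≤ exp (-1) → ψ₀ y = 1) ∧
      ∃ y : adicCompletion L w, Valued.v y ≤ exp 0 ∧ ψ₀ y ≠ 1 := by
  obtain ⟨σ, hσ⟩ := T5QuadraticGalois.exists_ne_one h2
  exact exists_char_trivial_on_base_conductor_neg_one v w h2 σ hσ hϖ hϖS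

end SigmaFree

section ConductorExp

open T5AdditiveConductor

variable {K : Type*} [Field K] [NumberField K] (v : HeightOneSpectrum (NumberField.RingOfIntegers K))
  {L : Type*} [Field L] [NumberField L] [Algebra K L]
  (w : HeightOneSpectrum (NumberField.RingOfIntegers L)) [w.asIdeal.LiesOver v.asIdeal]

/-- The same `ψ₀` with its conductor in the language of `T5AdditiveConductor.conductorExp`:
`n(ψ₀) = −1`. -/
theorem exists_char_trivial_on_base_conductorExp_eq_neg_one
    (h2 : Module.finrank (adicCompletion K v) (adicCompletion L w) = 2)
    {ϖ : adicCompletionIntegers K v} (hϖ : Irreducible ϖ)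
    (hϖS : Irreducible (algebraMap (adicCompletionIntegers K v) (adicCompletionIntegers L w) ϖ)) :
    ∃ ψ₀ : AddChar (adicCompletion L w) Circle, Continuous ψ₀ ∧
      (∀ a : adicCompletion K v, ψ₀ (algebraMap _ _ a) = 1) ∧
      conductorExp ψ₀ (Valued.v : Valuation (adicCompletion L w) ℤᵐ⁰) = -1 := by
  obtain ⟨ψ₀, hc, hK, h1, y, hy, hy1⟩ :=
    exists_char_trivial_on_base_conductor_neg_one' v w h2 hϖ hϖS
  refine ⟨ψ₀, hc, hK, conductorExp_eq_of ψ₀ _ (-1) h1 ?_ ⟨y, hy1⟩⟩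
  intro h
  exact hy1 (h y (by rw [show (-1 : ℤ) + 1 = 0 by norm_num]; exact hy))

end ConductorExp

end Summit.Ventures.HodgeRepro2.T5InertNormalizedCharacter
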